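import Summits.HodgeConjecture.CorCM.MultiFieldWeilAnyTwoSimpleDimLeThree
import Summits.HodgeConjecture.CorCM.ForeignQuadraticCMFieldsHodge
import Summits.HodgeConjecture.CorCM.IrreducibleOddWeightsHodgeGluingBlocks
import Summits.HodgeConjecture.CorCM.QuadraticCMFamiliesNonisogenous
import Literature.AlgebraicGeometry.Pohlmann1968.CMFamilyRankPartitionSlots
import HarnessLib

/-!
# MULTI-FIELD WEIL ENGINE — FOREIGN CM ELLIPTIC CURVES JOIN FOR FREE; ANY TWO CM ELLIPTIC CURVES × ANY SIMPLE CM THREEFOLD, given ONLY Markman's fourfold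
# theorem (the three-factor fivefolds `E × E′ × T` of Moonen–Zarhin (0.2))

Cell `pub-hodgecm2` (COR-CM), seat b30 gen 33 (2026-08-24); count-neutral own lane MULTI-FIELD WEIL ENGINE (stem `MultiFieldWeil*`).  Theorems only; no definition,
no named fact, no `sorry`.  HONEST FRAMING: §1–§2 are UNCONDITIONAL transfer statements (Mumford–Tate ranks and gluing of instances of the Hodge conjecture); §3 is
conditional on the displayed Markman fourfold binder only; `HC_CM` is NOT proved and not asserted.

THE POINT.  The engine's headlines, and seat b16's census, are statements about ALL products of copies of a family `(A_i)_i` of CM abelian varieties.  A CM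
elliptic curve `E′` with CM field `k′` is FOREIGN to the family if `k′` embeds in NO field `K_i` (for a quadratic `K_i = k`: `k′ ≄ k`).  Then `E′` (indeed any set
of such curves) SPLITS OFF the Hodge group: `Hg(∏_i A_i × ∏ E′) = Hg(∏_i A_i) × Hg(∏ E′)` (§1), because the character module of a foreign quadratic slot — the
`χ_{k′}`-line — has no constituent in common with `ℚ^{Hom(K_i, ℂ)}` (the stabiliser of `Hom(k′, ℂ)` in `Aut(ℂ)` is transitive on `Hom(K_i, ℂ)`: seat b16's
`pairwise_of_isEmpty`, Moonen–Zarhin (0.2) (4) ∕ Cor. (3.9)), and the pairwise criterion BETWEEN THE TWO BLOCKS {curves} ∕ {rest} is all that rank additivity over a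
partition asks (p2's `cmFamilyRank_add_card_eq_of_pairwise_slots_fiber` — nothing is asked INSIDE the rest block, which may be as degenerate as it likes).  By
b16's block gluing (`hodgeConjectureFor_biproduct_of_cmFamilyRank_fiber_add_card_eq`) the Hodge conjecture for all products of copies of the family and of the
curves separately gives it for all products of copies of both together (§2, **`hodgeConjectureFor_prod_of_foreignCurves`**).  This is NOT the gluing of
`CorCM/MultiFieldWeilBlockGluing.lean` (G8–G11: a partial conjugation, i.e. closure-composita meeting in a totally real field): for a simple CM threefold `T` with
`K_T = k · F`, `F` a non-cyclic cubic of discriminant `D`, the imaginary quadratic field `k′ = ℚ(√(−dD))` lies INSIDE the Galois closure of `K_T`, no partial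
conjugation separates `E′` from `(E, T)`, and yet `E′` splits off.

THE ROOF (§3, **`hodgeConjectureFor_biproduct_comp_vec_of_two_cmCurves_simpleThreefold_of_markman`**).  `E ⊨ (k; Ψ)`, `E′ ⊨ (k′; Ψ′)` ANY two CM elliptic
curves, `T ⊨ (K; Φ)` ANY simple CM abelian threefold — NOTHING assumed on the three fields.  Then the Hodge conjecture holds for EVERY `E^a × E′^b × T^c`
(`⨁_j ![E, E′, T] (κ j)`), GIVEN ONLY `Markman2025_weilClasses_algebraic_abelianFourfold`.  Cases: `k′ ≅ k` (then `E′ ∼ E`: a product of copies of `E, T` up to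
isogeny — gen 31's G6 `…cmCurve_simpleThreefold…`); `k′` foreign to `k` and `K` (§2 over G6); `k′ ↪ K` but `k′ ≄ k` (then `k ↪̸ K`, a sextic field having at most one
quadratic subfield — b16's `WeilFibre.nonempty_algEquiv_of_finrank_eq_two` — so `E` is the foreign curve).  With gen 31's roof for TWO simple CM varieties of
dimension `≤ 3` this settles the three-factor CM fivefolds `E × E′ × T` of Moonen–Zarhin's Thm. (0.2) (the case listed as open in this lane's census).

[cite: MoonenZarhin1999LowDim, Thm. (0.2), §3 (3.1), Cor. (3.9)] [cite: Gordon1999HodgeAVSurvey, §3 Theorem (proof), 7.5–7.7] [cite: Markman2025SurveySecant, Thm. 1.2]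
[cite: Shimura1998, §6.1 Corollary of Theorem 2 (p. 41)] [cite: MumfordAV1970, §19 Thm. 1 and p. 169]

## References
* [MoonenZarhin1999LowDim] B. Moonen, Yu. Zarhin, Math. Ann. 315 (1999) 711–733.  [Gordon1999HodgeAVSurvey] B. B. Gordon, *A survey of the Hodge conjecture for
  abelian varieties*, §3, 7.5–7.7.  [Markman2025SurveySecant] E. Markman, arXiv:2509.23403, Thm. 1.2.  [Shimura1998] G. Shimura, *Abelian varieties with complex
  multiplication and modular functions*, §6.1.  [MumfordAV1970] D. Mumford, *Abelian Varieties*, §19.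
-/

noncomputable section

open CategoryTheory CategoryTheory.Limits NumberField IntermediateField

namespace Summit.HodgeConjecture.CorCM.MultiFieldWeil

open Literature.AlgebraicGeometry Literature.AlgebraicGeometry.Motives Literature.AlgebraicGeometry.HodgeTheory
open Literature.AlgebraicGeometry.ComplexMultiplication (IsCMTypeRealisation)
open Literature.AlgebraicTopology.SingularHomology
open Literature.NumberTheory.ComplexMultiplication
open Literature.AlgebraicGeometry.Pohlmann1968
open Literature.AlgebraicGeometry.Milne1999 (IsOfCMType)

open scoped Classical

/-! ## §1 Foreign quadratic slots split off the Mumford–Tate rank -/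

section Rank

variable {I : Type} [Fintype I] {K : I → Type} [∀ i, Field (K i)] [∀ i, NumberField (K i)] [∀ i, IsCMField (K i)]

/-- **FOREIGN QUADRATIC SLOTS SPLIT OFF.**  `(Φ_i)_{i ∈ I}` CM types of CM fields `K_i`; `p` marks some slots with `[K_a : ℚ] = 2` such that NO marked field
embeds in an unmarked one (`IsEmpty (K a →+* K j)` for `p a`, `¬ p j`); both kinds occur.  Then the rank of the family is additive over the two blocks
`{p} ⊔ {¬p}`: `rank(Σ) + 2 = rank(Σ|_{p}) + rank(Σ|_{¬p}) + 1`, i.e. `Hg(∏_i A_i) = Hg(∏_{p a} A_a) × Hg(∏_{¬p j} A_j)` — nothing is asked inside either block.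
(p2's rank additivity over a partition from the slot criterion ACROSS blocks, the criterion for a marked∕unmarked pair being b16's `pairwise_of_isEmpty`: the
`χ_{k_a}`-isotypic line `U(Φ_a)` against `ℚ^{Hom(K_j, ℂ)}` without `χ_{k_a}`-eigenvectors.) [cite: MoonenZarhin1999LowDim, §3 (3.1) and Cor. (3.9)]
[cite: Gordon1999HodgeAVSurvey, §3 Theorem (proof)] -/
theorem cmFamilyRank_add_two_eq_of_foreign_quadratic (Φ : ∀ i, CMType (K i)) (p : I → Prop) [DecidablePred p]
    (h2 : ∀ a, p a → Module.finrank ℚ (K a) = 2) (hfor : ∀ a j, p a → ¬ p j → IsEmpty (K a →+* K j)) (hp : ∃ a, p a) (hnp : ∃ j, ¬ p j) :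
    CMAlgebra.cmFamilyRank Φ + Fintype.card Bool = (∑ c : Bool, CMAlgebra.cmFamilyRank fun i : {i : I // decide (p i) = c} => Φ i.1) + 1 := by
  obtain ⟨a₀, ha₀⟩ := hp
  haveI : Nonempty I := ⟨a₀⟩
  refine CMAlgebra.cmFamilyRank_add_card_eq_of_pairwise_slots_fiber Φ (fun i => decide (p i)) (fun c => ?_) (fun i j hij => ?_)
  · cases c
    · obtain ⟨j, hj⟩ := hnp
      exact ⟨j, decide_eq_false hj⟩
    · exact ⟨a₀, decide_eq_true ha₀⟩
  · by_cases hi : p i <;> by_cases hj : p j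
    · exact absurd ((decide_eq_true hi).trans (decide_eq_true hj).symm) hij
    · exact (pairwise_of_isEmpty Φ (h2 i hi) (hfor i j hi hj)).1
    · exact (pairwise_of_isEmpty Φ (h2 j hj) (hfor j i hj hi)).2
    · exact absurd ((decide_eq_false hi).trans (decide_eq_false hj).symm) hij

end Rank

/-! ## §2 The Hodge conjecture glues a family and its foreign CM elliptic curves -/

section Glue

variable {I : Type} [Fintype I] {K : I → Type} [∀ i, Field (K i)] [∀ i, NumberField (K i)] [∀ i, IsCMField (K i)]
  {Φ : ∀ i, CMType (K i)} {A : I → AbelianVariety ℂ} {ι : ∀ i, 𝓞 (K i) →+* End (A i)} {θ : ∀ i, K i →+* Module.End ℂ (complexBetti (A i).X 1)}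

/-- **FOREIGN CM ELLIPTIC CURVES JOIN FOR FREE.**  `A_i ⊨ (K_i; Φ_i)` (`i ∈ I` finite) realisations; the slots marked by `p` are CM elliptic curves
(`[K_a : ℚ] = 2`) whose fields embed in NO unmarked field (`IsEmpty (K a →+* K j)`; against an unmarked quadratic field this says `K_a ≄ K_j`); both kinds occur.
IF the Hodge conjecture holds for every product of copies of the marked curves among themselves AND for every product of copies of the unmarked members among
themselves, THEN it holds for EVERY product of copies `⨁_j A_{π j}` of the whole family — UNCONDITIONALLY (§1 and seat b16's block gluing
`hodgeConjectureFor_biproduct_of_cmFamilyRank_fiber_add_card_eq`).  Typical unmarked blocks: any headline of this engine; typical marked block: one curve (its powers,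
Moonen–Zarhin (5.2)). [cite: MoonenZarhin1999LowDim, §3 (3.1), Cor. (3.9) and §5 (5.2)] [cite: Gordon1999HodgeAVSurvey, §3 Theorem (proof), 7.5–7.7] -/
theorem hodgeConjectureFor_prod_of_foreignCurves (hA : ∀ i, IsCMTypeRealisation (Φ i) (A i) (ι i) (θ i)) (p : I → Prop) [DecidablePred p]
    (h2 : ∀ a, p a → Module.finrank ℚ (K a) = 2) (hfor : ∀ a j, p a → ¬ p j → IsEmpty (K a →+* K j)) (hp : ∃ a, p a) (hnp : ∃ j, ¬ p j)
    (hcurves : ∀ (M : ℕ) (ρ : Fin M → I), (∀ l, p (ρ l)) → HodgeConjectureFor (⨁ fun l => A (ρ l)).dim (⨁ fun l => A (ρ l)).X)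
    (hrest : ∀ (M : ℕ) (ρ : Fin M → I), (∀ l, ¬ p (ρ l)) → HodgeConjectureFor (⨁ fun l => A (ρ l)).dim (⨁ fun l => A (ρ l)).X)
    {N : ℕ} (π : Fin N → I) : HodgeConjectureFor (⨁ fun j => A (π j)).dim (⨁ fun j => A (π j)).X := by
  cases N with
  | zero => exact hrest 0 π fun l => l.elim0
  | succ N =>
    refine hodgeConjectureFor_biproduct_of_cmFamilyRank_fiber_add_card_eq (fun i => decide (p i)) (fun c => ?_)
      (cmFamilyRank_add_two_eq_of_foreign_quadratic Φ p h2 hfor hp hnp) hA (fun c J _ _ π' => ?_) π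
    · cases c
      · obtain ⟨j, hj⟩ := hnp
        exact ⟨j, decide_eq_false hj⟩
      · obtain ⟨a, ha⟩ := hp
        exact ⟨a, decide_eq_true ha⟩
    · -- re-index the `J`-indexed product of members of the block `c` by `Fin |J|`
      let ε : Fin (Fintype.card J) ≃ J := (Fintype.equivFin J).symm
      have hdom : Domination.AVDominatedBy (⨁ fun j => A (π' j).1) (⨁ fun l => A (π' (ε l)).1) :=
        Domination.AVDominatedBy.of_iso (biproduct.reindex ε fun j => A (π' j).1).symm (Domination.AVDominatedBy.refl _)
      refine Domination.hodgeConjectureFor_of_avDominatedBy ?_ hdom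
      cases c
      · exact hrest _ (fun l => (π' (ε l)).1) fun l => of_decide_eq_false (π' (ε l)).2
      · exact hcurves _ (fun l => (π' (ε l)).1) fun l => of_decide_eq_true (π' (ε l)).2

/-- **Dominated form** of `hodgeConjectureFor_prod_of_foreignCurves`. [cite: MoonenZarhin1999LowDim, §3 (3.1)] [cite: MumfordAV1970, §19 Thm. 1 and p. 169] -/
theorem hodgeConjectureFor_of_avDominatedBy_prod_of_foreignCurves (hA : ∀ i, IsCMTypeRealisation (Φ i) (A i) (ι i) (θ i)) (p : I → Prop)
    [DecidablePred p] (h2 : ∀ a, p a → Module.finrank ℚ (K a) = 2) (hfor : ∀ a j, p a → ¬ p j → IsEmpty (K a →+* K j)) (hp : ∃ a, p a)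
    (hnp : ∃ j, ¬ p j)
    (hcurves : ∀ (M : ℕ) (ρ : Fin M → I), (∀ l, p (ρ l)) → HodgeConjectureFor (⨁ fun l => A (ρ l)).dim (⨁ fun l => A (ρ l)).X)
    (hrest : ∀ (M : ℕ) (ρ : Fin M → I), (∀ l, ¬ p (ρ l)) → HodgeConjectureFor (⨁ fun l => A (ρ l)).dim (⨁ fun l => A (ρ l)).X)
    {N : ℕ} (π : Fin N → I) {X : AbelianVariety ℂ} (hX : Domination.AVDominatedBy X (⨁ fun j => A (π j))) : HodgeConjectureFor X.dim X.X :=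
  Domination.hodgeConjectureFor_of_avDominatedBy (hodgeConjectureFor_prod_of_foreignCurves hA p h2 hfor hp hnp hcurves hrest π) hX

end Glue

/-! ## §3 Any two CM elliptic curves and any simple CM threefold -/

section TwoCurves

variable {k k' K : Type} [Field k] [NumberField k] [IsCMField k] [Field k'] [NumberField k'] [IsCMField k'] [Field K] [NumberField K] [IsCMField K]
  {N : ℕ} {E E' T : AbelianVariety ℂ} {Ψ : CMType k} {Ψ' : CMType k'} {Φ : CMType K}
  {ιE : 𝓞 k →+* End E} {θE : k →+* Module.End ℂ (complexBetti E.X 1)}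
  {ιE' : 𝓞 k' →+* End E'} {θE' : k' →+* Module.End ℂ (complexBetti E'.X 1)}
  {ιT : 𝓞 K →+* End T} {θT : K →+* Module.End ℂ (complexBetti T.X 1)}

omit [NumberField k] [IsCMField k] [IsCMField k'] [NumberField K] [IsCMField K] in
/-- **Products of copies of ONE CM elliptic curve** satisfy the Hodge conjecture (a product of copies is an isogeny factor of a power; powers of a CM variety of
dimension `≤ 3`, Moonen–Zarhin (5.2), seat b16) — UNCONDITIONAL. [cite: MoonenZarhin1999LowDim, §5 (5.2)] [cite: Gordon1999HodgeAVSurvey, 7.6.1 and 10.10] -/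
theorem hodgeConjectureFor_biproduct_const_of_cmCurve (h2' : Module.finrank ℚ k' = 2) (hE' : IsCMTypeRealisation Ψ' E' ιE' θE') (M : ℕ) :
    HodgeConjectureFor (⨁ fun _ : Fin M => E').dim (⨁ fun _ : Fin M => E').X := by
  have hcm : IsOfCMType E' := isOfCMType_of_isCMTypeRealisation hE'
  have hdim : E'.dim ≤ 3 := by
    rw [AndreProductForm.dim_eq_of_isCMTypeRealisation hE', h2']
    norm_num
  obtain ⟨Mpow, hdom⟩ := exists_avDominatedBy_biproduct_slots_powSucc (A' := fun _ : Unit => E') (cls := fun _ : Fin 1 => ()) (X := E')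
    (fun u => ⟨0, by cases u; rfl⟩) (Literature.AlgebraicGeometry.Pohlmann1968.isIsogenous_powSucc_biproduct E' 0) (fun _ : Fin M => ())
  exact hodgeConjectureFor_of_avDominatedBy_powSucc_of_isOfCMType_of_dim_le_three hcm hdim hdom

omit [NumberField k'] [IsCMField k'] in
/-- **`E′ ∼ E`**: every product of copies of `E, E′, T` is isogenous to a product of copies of `E, T` (gen 31's G6, ANY CM elliptic curve × ANY simple CM threefold,
isogenous form), GIVEN ONLY Markman's fourfold theorem. [cite: Markman2025SurveySecant, Thm. 1.2] [cite: MoonenZarhin1999LowDim, Thm. (0.1) (1), (4) with case (a)] -/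
theorem hodgeConjectureFor_biproduct_comp_vec_of_isIsogenous_cmCurves_simpleThreefold_of_markman (hW4 : Markman2025_weilClasses_algebraic_abelianFourfold)
    (h2 : Module.finrank ℚ k = 2) (h6 : Module.finrank ℚ K = 6) (hE : IsCMTypeRealisation Ψ E ιE θE) (hT : IsCMTypeRealisation Φ T ιT θT) (hS : T.IsSimple)
    (hEE' : AbelianVariety.IsIsogenous E E') (κ : Fin N → Fin 3) :
    HodgeConjectureFor (⨁ fun j => (![E, E', T] : Fin 3 → AbelianVariety ℂ) (κ j)).dim (⨁ fun j => (![E, E', T] : Fin 3 → AbelianVariety ℂ) (κ j)).X := by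
  let cls : Fin N → Fin 2 := fun j => if κ j = 2 then 1 else 0
  have hX : AbelianVariety.IsIsogenous (⨁ fun j => (![E, E', T] : Fin 3 → AbelianVariety ℂ) (κ j))
      (⨁ fun j => (![E, T] : Fin 2 → AbelianVariety ℂ) (cls j)) := by
    refine AbelianVariety.IsIsogenous.biproduct fun j => ?_
    show AbelianVariety.IsIsogenous ((![E, E', T] : Fin 3 → AbelianVariety ℂ) (κ j)) ((![E, T] : Fin 2 → AbelianVariety ℂ) (if κ j = 2 then 1 else 0))
    generalize κ j = c
    fin_cases c
    · exact AbelianVariety.IsIsogenous.refl E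
    · exact hEE'.symm'
    · exact AbelianVariety.IsIsogenous.refl T
  exact hodgeConjectureFor_of_isIsogenous_biproduct_comp_of_cmCurve_simpleThreefold_of_markman hW4 h2 h6 hE hT hS cls hX

/-- **`E′` FOREIGN to `k` and `K`**: if `k′` embeds neither in `k` nor in `K`, the Hodge conjecture holds for every product of copies of `E, E′, T`, GIVEN ONLY
Markman's fourfold theorem — §2 over the blocks `{E′}` (its powers, unconditional) and `{E, T}` (gen 31's G6). [cite: MoonenZarhin1999LowDim, Thm. (0.2), §3 (3.1), Cor. (3.9)]
[cite: Markman2025SurveySecant, Thm. 1.2] -/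
theorem hodgeConjectureFor_biproduct_comp_vec_of_foreignCurve_cmCurve_simpleThreefold_of_markman (hW4 : Markman2025_weilClasses_algebraic_abelianFourfold)
    (h2 : Module.finrank ℚ k = 2) (h2' : Module.finrank ℚ k' = 2) (h6 : Module.finrank ℚ K = 6) (hE : IsCMTypeRealisation Ψ E ιE θE)
    (hE' : IsCMTypeRealisation Ψ' E' ιE' θE') (hT : IsCMTypeRealisation Φ T ιT θT) (hS : T.IsSimple) (hk'k : IsEmpty (k' →+* k)) (hk'K : IsEmpty (k' →+* K))
    (κ : Fin N → Fin 3) :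
    HodgeConjectureFor (⨁ fun j => (![E, E', T] : Fin 3 → AbelianVariety ℂ) (κ j)).dim (⨁ fun j => (![E, E', T] : Fin 3 → AbelianVariety ℂ) (κ j)).X := by
  -- the family of fields `(k, k', K)` with its instances (all identifications below are definitional)
  let Kf : Fin 3 → Type := Fin.cons k (Fin.cons k' (Fin.cons K finZeroElim))
  letI instF : ∀ j, Field (Kf j) := Fin.cons ‹Field k› (Fin.cons ‹Field k'› (Fin.cons ‹Field K› finZeroElim))
  letI instN : ∀ j, NumberField (Kf j) := Fin.cons ‹NumberField k› (Fin.cons ‹NumberField k'› (Fin.cons ‹NumberField K› finZeroElim))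
  haveI instC : ∀ j, IsCMField (Kf j) := Fin.cons ‹IsCMField k› (Fin.cons ‹IsCMField k'› (Fin.cons ‹IsCMField K› finZeroElim))
  let Φf : ∀ j : Fin 3, CMType (Kf j) := Fin.cons Ψ (Fin.cons Ψ' (Fin.cons Φ finZeroElim))
  let ιf : ∀ j : Fin 3, 𝓞 (Kf j) →+* End ((![E, E', T] : Fin 3 → AbelianVariety ℂ) j) := Fin.cons ιE (Fin.cons ιE' (Fin.cons ιT finZeroElim))
  let θf : ∀ j : Fin 3, Kf j →+* Module.End ℂ (complexBetti ((![E, E', T] : Fin 3 → AbelianVariety ℂ) j).X 1) :=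
    Fin.cons θE (Fin.cons θE' (Fin.cons θT finZeroElim))
  have hA : ∀ j, IsCMTypeRealisation (Φf j) ((![E, E', T] : Fin 3 → AbelianVariety ℂ) j) (ιf j) (θf j) :=
    Fin.cons hE (Fin.cons hE' (Fin.cons hT finZeroElim))
  refine hodgeConjectureFor_prod_of_foreignCurves (K := Kf) (A := (![E, E', T] : Fin 3 → AbelianVariety ℂ)) hA (fun i => i = 1) ?_ ?_ ⟨1, rfl⟩
    ⟨0, by decide⟩ ?_ ?_ κ
  · -- the marked slot is `k'`
    intro a ha
    subst ha
    exact h2'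
  · -- `k'` embeds neither in `k` nor in `K`
    intro a j ha hj
    subst ha
    fin_cases j
    · exact hk'k
    · exact absurd rfl hj
    · exact hk'K
  · -- products of copies of `E'`
    intro M ρ hρ
    have hfun : (fun l => (![E, E', T] : Fin 3 → AbelianVariety ℂ) (ρ l)) = fun _ => E' := funext fun l => by rw [hρ l]; rfl
    rw [hfun]
    exact hodgeConjectureFor_biproduct_const_of_cmCurve h2' hE' M
  · -- products of copies of `E` and `T`: gen 31's G6
    intro M ρ hρ
    have key : ∀ i : Fin 3, i ≠ 1 → (![E, E', T] : Fin 3 → AbelianVariety ℂ) i = (![E, T] : Fin 2 → AbelianVariety ℂ) (if i = 0 then 0 else 1) := by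
      intro i hi
      fin_cases i
      · rfl
      · exact absurd rfl hi
      · rfl
    have hfun : (fun l => (![E, E', T] : Fin 3 → AbelianVariety ℂ) (ρ l)) =
        fun l => (![E, T] : Fin 2 → AbelianVariety ℂ) (if ρ l = 0 then 0 else 1) := funext fun l => key (ρ l) (hρ l)
    rw [hfun]
    exact hodgeConjectureFor_biproduct_comp_vec_of_cmCurve_simpleThreefold_of_markman hW4 h2 h6 hE hT hS fun l => if ρ l = 0 then 0 else 1

omit [NumberField k] [IsCMField k] [NumberField k'] [IsCMField k'] [NumberField K] [IsCMField K] in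
/-- Swapping the two curves: `⨁_j ![E′, E, T] (swap 0 1 (κ j)) = ⨁_j ![E, E′, T] (κ j)` (the families agree pointwise). [folklore] -/
theorem biproduct_vec_three_swap (κ : Fin N → Fin 3) :
    (fun j => (![E', E, T] : Fin 3 → AbelianVariety ℂ) (Equiv.swap (0 : Fin 3) 1 (κ j))) = fun j => (![E, E', T] : Fin 3 → AbelianVariety ℂ) (κ j) := by
  funext j
  generalize κ j = c
  fin_cases c
  · rfl
  · rfl
  · rfl

/-- **MAIN THEOREM — ANY TWO CM ELLIPTIC CURVES AND ANY SIMPLE CM THREEFOLD, given ONLY Markman's fourfold theorem.**  `E ⊨ (k; Ψ)`, `E′ ⊨ (k′; Ψ′)` CM elliptic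
curves (imaginary quadratic `k`, `k′`), `T ⊨ (K; Φ)` a SIMPLE abelian threefold with CM by a sextic CM field `K` — NOTHING assumed on the three fields or on the
types.  Then for every `κ : Fin N → Fin 3` — every `E^a × E′^b × T^c` — the Hodge conjecture holds for `⨁_j ![E, E′, T] (κ j)`, GIVEN ONLY
`Markman2025_weilClasses_algebraic_abelianFourfold`.  Cases: `k′ ≅ k` (`E′ ∼ E`, seat b16's `isIsogenous_of_ringEquiv`); `k′` foreign to `k` and `K` (§2); `k′ ↪ K`,
`k′ ≄ k` — then `k` does not embed in `K` (a sextic field has at most one quadratic subfield, `WeilFibre.nonempty_algEquiv_of_finrank_eq_two`), so `E` is foreign to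
`k′` and `K` (§2 with the curves swapped).  The three-factor fivefolds `E × E′ × T` of Moonen–Zarhin's classification; `HC_CM` is NOT asserted.
[cite: MoonenZarhin1999LowDim, Thm. (0.2), §3 (3.1), Cor. (3.9), §5 (5.2)] [cite: Markman2025SurveySecant, Thm. 1.2] [cite: Shimura1998, §6.1 Corollary of Theorem 2 (p. 41)] -/
theorem hodgeConjectureFor_biproduct_comp_vec_of_two_cmCurves_simpleThreefold_of_markman (hW4 : Markman2025_weilClasses_algebraic_abelianFourfold)
    (h2 : Module.finrank ℚ k = 2) (h2' : Module.finrank ℚ k' = 2) (h6 : Module.finrank ℚ K = 6) (hE : IsCMTypeRealisation Ψ E ιE θE)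
    (hE' : IsCMTypeRealisation Ψ' E' ιE' θE') (hT : IsCMTypeRealisation Φ T ιT θT) (hS : T.IsSimple) (κ : Fin N → Fin 3) :
    HodgeConjectureFor (⨁ fun j => (![E, E', T] : Fin 3 → AbelianVariety ℂ) (κ j)).dim (⨁ fun j => (![E, E', T] : Fin 3 → AbelianVariety ℂ) (κ j)).X := by
  by_cases hkk : Nonempty (k' →+* k)
  · -- `k' ≅ k`: `E' ∼ E`
    obtain ⟨f⟩ := hkk
    obtain ⟨e⟩ := exists_ringEquiv_of_ringHom_of_finrank_eq f (h2'.trans h2.symm)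
    exact hodgeConjectureFor_biproduct_comp_vec_of_isIsogenous_cmCurves_simpleThreefold_of_markman hW4 h2 h6 hE hT hS
      (isIsogenous_of_ringEquiv h2 hE hE' e) κ
  rw [not_nonempty_iff] at hkk
  by_cases hk'K : IsEmpty (k' →+* K)
  · -- `k'` foreign to `k` and `K`
    exact hodgeConjectureFor_biproduct_comp_vec_of_foreignCurve_cmCurve_simpleThreefold_of_markman hW4 h2 h2' h6 hE hE' hT hS hkk hk'K κ
  · -- `k' ↪ K`: then `k` does not embed in `K`, and `E` is the foreign curve
    obtain ⟨i'⟩ := not_isEmpty_iff.1 hk'K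
    have hkK : IsEmpty (k →+* K) := by
      refine ⟨fun i => ?_⟩
      obtain ⟨e⟩ := WeilFibre.nonempty_algEquiv_of_finrank_eq_two (M := K) h2' h2 (by rw [h6]; decide) i'.toRatAlgHom i.toRatAlgHom
      exact hkk.false e.toRingEquiv.toRingHom
    have hkk' : IsEmpty (k →+* k') := by
      refine ⟨fun g => ?_⟩
      obtain ⟨e⟩ := exists_ringEquiv_of_ringHom_of_finrank_eq g (h2.trans h2'.symm)
      exact hkk.false e.symm.toRingHom
    have h := hodgeConjectureFor_biproduct_comp_vec_of_foreignCurve_cmCurve_simpleThreefold_of_markman hW4 h2' h2 h6 hE' hE hT hS hkk' hkK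
      (fun j => Equiv.swap (0 : Fin 3) 1 (κ j))
    rw [biproduct_vec_three_swap κ] at h
    exact h

/-- **`E × E′ × T` itself**, for ANY two CM elliptic curves and ANY simple CM threefold, given only Markman's fourfold theorem. [cite: MoonenZarhin1999LowDim, Thm. (0.2)]
[cite: Markman2025SurveySecant, Thm. 1.2] -/
theorem hodgeConjectureFor_biproduct_vec_of_two_cmCurves_simpleThreefold_of_markman (hW4 : Markman2025_weilClasses_algebraic_abelianFourfold)
    (h2 : Module.finrank ℚ k = 2) (h2' : Module.finrank ℚ k' = 2) (h6 : Module.finrank ℚ K = 6) (hE : IsCMTypeRealisation Ψ E ιE θE)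
    (hE' : IsCMTypeRealisation Ψ' E' ιE' θE') (hT : IsCMTypeRealisation Φ T ιT θT) (hS : T.IsSimple) :
    HodgeConjectureFor (⨁ (![E, E', T] : Fin 3 → AbelianVariety ℂ)).dim (⨁ (![E, E', T] : Fin 3 → AbelianVariety ℂ)).X :=
  hodgeConjectureFor_biproduct_comp_vec_of_two_cmCurves_simpleThreefold_of_markman hW4 h2 h2' h6 hE hE' hT hS (id : Fin 3 → Fin 3)

/-- **Dominated form**: everything dominated by a product of copies of two CM elliptic curves and a simple CM threefold — everything isogenous to some
`E^a × E′^b × T^c`, every abelian subvariety or quotient of one — given only Markman's fourfold theorem. [cite: MoonenZarhin1999LowDim, Thm. (0.2)]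
[cite: Markman2025SurveySecant, Thm. 1.2] [cite: MumfordAV1970, §19 Thm. 1 and p. 169] -/
theorem hodgeConjectureFor_of_avDominatedBy_comp_vec_of_two_cmCurves_simpleThreefold_of_markman (hW4 : Markman2025_weilClasses_algebraic_abelianFourfold)
    (h2 : Module.finrank ℚ k = 2) (h2' : Module.finrank ℚ k' = 2) (h6 : Module.finrank ℚ K = 6) (hE : IsCMTypeRealisation Ψ E ιE θE)
    (hE' : IsCMTypeRealisation Ψ' E' ιE' θE') (hT : IsCMTypeRealisation Φ T ιT θT) (hS : T.IsSimple) (κ : Fin N → Fin 3) {X : AbelianVariety ℂ}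
    (hX : Domination.AVDominatedBy X (⨁ fun j => (![E, E', T] : Fin 3 → AbelianVariety ℂ) (κ j))) : HodgeConjectureFor X.dim X.X :=
  Domination.hodgeConjectureFor_of_avDominatedBy
    (hodgeConjectureFor_biproduct_comp_vec_of_two_cmCurves_simpleThreefold_of_markman hW4 h2 h2' h6 hE hE' hT hS κ) hX

/-- **Every abelian variety ISOGENOUS TO A PRODUCT OF COPIES of `E, E′, T`** (any finite index type), given only Markman's fourfold theorem.
[cite: MoonenZarhin1999LowDim, Thm. (0.2)] [cite: Markman2025SurveySecant, Thm. 1.2] [cite: MumfordAV1970, §19] -/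
theorem hodgeConjectureFor_of_isIsogenous_biproduct_comp_of_two_cmCurves_simpleThreefold_of_markman (hW4 : Markman2025_weilClasses_algebraic_abelianFourfold)
    (h2 : Module.finrank ℚ k = 2) (h2' : Module.finrank ℚ k' = 2) (h6 : Module.finrank ℚ K = 6) (hE : IsCMTypeRealisation Ψ E ιE θE)
    (hE' : IsCMTypeRealisation Ψ' E' ιE' θE') (hT : IsCMTypeRealisation Φ T ιT θT) (hS : T.IsSimple) {J : Type} [Fintype J] (cls : J → Fin 3)
    {X : AbelianVariety ℂ} (hX : AbelianVariety.IsIsogenous X (⨁ fun j => (![E, E', T] : Fin 3 → AbelianVariety ℂ) (cls j))) :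
    HodgeConjectureFor X.dim X.X := by
  classical
  let ε : Fin (Fintype.card J) ≃ J := (Fintype.equivFin J).symm
  have e : (⨁ fun j => (![E, E', T] : Fin 3 → AbelianVariety ℂ) (cls j)) ≅ ⨁ fun l => (![E, E', T] : Fin 3 → AbelianVariety ℂ) (cls (ε l)) :=
    (biproduct.reindex ε fun j => (![E, E', T] : Fin 3 → AbelianVariety ℂ) (cls j)).symm
  exact hodgeConjectureFor_of_avDominatedBy_comp_vec_of_two_cmCurves_simpleThreefold_of_markman hW4 h2 h2' h6 hE hE' hT hS (fun l => cls (ε l))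
    (Domination.AVDominatedBy.of_isIsogenous hX (Domination.AVDominatedBy.of_iso e (Domination.AVDominatedBy.refl _)))

end TwoCurves

end Summit.HodgeConjecture.CorCM.MultiFieldWeil

end
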